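import Summits.ResolutionOfSingularities.ResolutionOfSingularities.Theorems.FrobeniusLadderFRationalResolutionColonCapturingMultiplier
import Summits.ResolutionOfSingularities.ResolutionOfSingularities.Theorems.FrobeniusLadderFRationalResolutionColonCapturingPrefix
import Summits.ResolutionOfSingularities.ResolutionOfSingularities.Theorems.FrobeniusLadderFRationalResolutionColonCapturingLifts
import Summits.ResolutionOfSingularities.ResolutionOfSingularities.Theorems.FrobeniusLadderFRationalResolutionColonCapturingUpstairs
import Summits.ResolutionOfSingularities.ResolutionOfSingularities.Theorems.FrobeniusLadderFRationalResolutionPartialSopTightlyClosed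
import Literature.AlgebraicGeometry.Resolution.RegularLocalRingsQuotient
import Literature.RingTheory.KrullDimension.AffineDimension
import Mathlib.RingTheory.Regular.RegularSequence
import Mathlib.Algebra.CharP.Quotient
import HarnessLib

/-!
# F-rational ⇒ Cohen–Macaulay, ring level (Hochster–Huneke 1994, Thm. 4.2 (c)), for quotients of
# regular local rings

Route `FrobeniusLadder`, crux stmt-ResolutionOfSingularities-15317 `FRationalResolution`, line
`Sketch`, by-product program "rung 3 ⇒ rung 2". Let `S` be a regular local ring of prime
characteristic `p`, `Q` a prime ideal and `R = S/Q`. If every ideal of `R` generated by a system of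
parameters is tightly closed (the inline F-rational clause of the route), then **every system of
parameters of `R` is a (weakly) regular sequence** — `R` is Cohen–Macaulay in the form used by rung 2
(`FInjectiveMacaulayfication`: `RingTheory.Sequence.IsWeaklyRegular R (List.ofFn s)`).

Proof (Hochster–Huneke 1990 §7 / 1994 Thm. 4.2 (c); Huneke, *Tight closure and its applications*,
Thm. 3.1 — colon capturing): given a system of parameters `s` of `R` and `v·sᵢ ∈ (s_{<i})`,
choose `y ⊆ Q` with `dim S/(y) = dim R` (`colonCapturing_exists_prefix`), lifts `x` of `s` with
`(y, x)` a system of parameters of `S` (`colonCapturing_exists_lifts`), and `c ∉ Q`, `N` with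
`c·Q^N ⊆ (y)` (`colonCapturing_exists_mul_pow_mem`, `Q` being minimal over `(y)` for dimension
reasons); colon capturing upstairs (`colonCapturing_quotient`: `(y, x^q)` is a regular sequence of
the regular local ring `S`) gives `c·u^q ∈ (x_{<i}^q) + Q` for `q = p^e ≫ 0`, i.e. `v ∈ (s_{<i})^*`
downstairs; and partial parameter ideals of an F-rational local ring are tightly closed
(`isTightlyClosed_span_image_Iio_of_isFRational`), so `v ∈ (s_{<i})`.
-/

-- single-problem summit: the doubled namespace component `ResolutionOfSingularities` is forced
set_option linter.dupNamespace false

noncomputable section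

open IsLocalRing Literature.RingTheory.TightClosure Literature.AlgebraicGeometry.Resolution

namespace Summit.ResolutionOfSingularities.ResolutionOfSingularities.Theorems.FRationalResolution

/-- A quotient of a ring of prime characteristic `p` by a proper ideal has characteristic `p`
(the prime field `𝔽_p ⊆ S` meets `Q` only in `0`). -/
theorem charP_quotient_of_ne_top (p : ℕ) [Fact p.Prime] {S : Type} [CommRing S] [CharP S p]
    (Q : Ideal S) (hQ : Q ≠ ⊤) : CharP (S ⧸ Q) p := by
  refine CharP.quotient' p Q fun x hx => ?_
  by_contra hne
  have hndvd : ¬ p ∣ x := fun h => hne ((CharP.cast_eq_zero_iff S p x).mpr h)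
  have hcop : x.Coprime p := ((Nat.Prime.coprime_iff_not_dvd Fact.out).mpr hndvd).symm
  have hu : IsUnit ((x : ZMod p) : ZMod p) := (ZMod.unitOfCoprime x hcop).isUnit
  have hu' : IsUnit ((x : S)) := by
    have := hu.map (ZMod.castHom (dvd_refl p) S)
    simpa only [map_natCast] using this
  exact hQ (Ideal.eq_top_of_isUnit_mem Q hx hu')

/-- Primes `P ≤ Q` with `dim S/P = dim S/Q = d` (a natural number) are equal. -/
theorem eq_of_le_of_ringKrullDim_quotient_eq' {S : Type} [CommRing S] {P Q : Ideal S}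
    (hP : P.IsPrime) (hle : P ≤ Q) {d : ℕ} (hp : ringKrullDim (S ⧸ P) = d)
    (hq : ringKrullDim (S ⧸ Q) = d) : P = Q := by
  by_contra hne
  have hlt : P < Q := lt_of_le_of_ne hle hne
  haveI : IsDomain (S ⧸ P) := Ideal.Quotient.isDomain P
  -- the image of `Q` in the domain `S/P` is a nonzero ideal
  have hne' : Q.map (Ideal.Quotient.mk P) ≠ ⊥ := by
    intro h
    apply not_le_of_gt hlt
    intro z hz
    have : Ideal.Quotient.mk P z ∈ Q.map (Ideal.Quotient.mk P) := Ideal.mem_map_of_mem _ hz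
    rw [h, Ideal.mem_bot, Ideal.Quotient.eq_zero_iff_mem] at this
    exact this
  have h1 := Literature.RingTheory.KrullDimension.ringKrullDim_quotient_add_one_le hne'
  have h2 : ringKrullDim ((S ⧸ P) ⧸ Q.map (Ideal.Quotient.mk P)) = ringKrullDim (S ⧸ Q) :=
    ringKrullDim_eq_of_ringEquiv (DoubleQuot.quotQuotEquivQuotOfLE hle)
  rw [h2, hp, hq] at h1
  have h' : ((d + 1 : ℕ) : WithBot ℕ∞) ≤ ((d : ℕ) : WithBot ℕ∞) := by push_cast; exact h1
  have : d + 1 ≤ d := by exact_mod_cast h'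
  omega

/-- `Ideal.ofList ((List.ofFn s).take i) = Ideal.span (s '' Set.Iio i)`: the ideal of the first `i`
members of the list of a `Fin d`-family. -/
theorem ofList_take_ofFn_eq_span_image_Iio {R : Type} [CommRing R] {d : ℕ} (s : Fin d → R)
    (i : Fin d) : Ideal.ofList ((List.ofFn s).take i) = Ideal.span (s '' Set.Iio i) := by
  change Ideal.span {r | r ∈ (List.ofFn s).take i} = Ideal.span (s '' Set.Iio i)
  congr 1
  ext r
  rw [Set.mem_setOf_eq, colonCapturing_quotient_mem_take_ofFn]
  constructor
  · rintro ⟨j, hj, rfl⟩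
    exact ⟨j, hj, rfl⟩
  · rintro ⟨j, hj, rfl⟩
    exact ⟨j, hj, rfl⟩

/-- The regularity of `a` on `R ⧸ I` (as an `R`-module, `I • ⊤ = I`) from the colon condition
`v·a ∈ I ⇒ v ∈ I`. -/
theorem isSMulRegular_quotient_of_colon {R : Type} [CommRing R] (I : Ideal R) (a : R)
    (h : ∀ v : R, v * a ∈ I → v ∈ I) :
    IsSMulRegular (R ⧸ (I • ⊤ : Submodule R R)) a := by
  have hI : (I • ⊤ : Submodule R R) = I := by
    rw [Ideal.smul_eq_mul]
    exact Ideal.mul_top I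
  intro m m' hmm'
  induction m using Submodule.Quotient.induction_on with
  | H v =>
    induction m' using Submodule.Quotient.induction_on with
    | H w =>
      rw [Submodule.Quotient.eq, hI]
      have h1 : (Submodule.Quotient.mk (a • v) : R ⧸ (I • ⊤ : Submodule R R)) =
          Submodule.Quotient.mk (a • w) := by
        simpa only [Submodule.Quotient.mk_smul] using hmm'
      rw [Submodule.Quotient.eq, hI] at h1
      have h2 : (v - w) * a ∈ I := by
        have : a • v - a • w = (v - w) * a := by simp only [smul_eq_mul]; ring
        rwa [this] at h1
      exact h (v - w) h2

/-- **F-rational ⇒ Cohen–Macaulay** (Hochster–Huneke 1994, Thm. 4.2 (c)), ring level. Let `S` be a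
regular local ring of prime characteristic `p`, `Q` a prime ideal, and suppose every ideal of
`R = S/Q` generated by a system of parameters is tightly closed in the inline sense of route
`FrobeniusLadder` (`c ≠ 0 ∧ (∀ e, c·y^(p^e) ∈ (s)^[p^e]) ⇒ y ∈ (s)`). Then every system of
parameters `s` of `R` (`dim R` elements with `rad (s)` maximal) is a weakly regular sequence on
`R`. -/
theorem isWeaklyRegular_of_fRational_clause_quotient (p : ℕ) [Fact p.Prime] (S : Type)
    [CommRing S] [IsRegularLocalRing S] [CharP S p] (Q : Ideal S) [Q.IsPrime]
    (hFR : ∀ d : ℕ, ringKrullDim (S ⧸ Q) = d → ∀ s : Fin d → S ⧸ Q,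
      (Ideal.span (Set.range s)).radical.IsMaximal → ∀ y c : S ⧸ Q, c ≠ 0 →
      (∀ e : ℕ, c * y ^ p ^ e ∈ Ideal.span ((fun z : S ⧸ Q => z ^ p ^ e) ''
        (Ideal.span (Set.range s) : Set (S ⧸ Q)))) → y ∈ Ideal.span (Set.range s))
    {d : ℕ} (hd : ringKrullDim (S ⧸ Q) = d) (s : Fin d → S ⧸ Q)
    (hs : (Ideal.span (Set.range s)).radical.IsMaximal) :
    RingTheory.Sequence.IsWeaklyRegular (S ⧸ Q) (List.ofFn s) := by
  classical
  -- the quotient `R = S/Q`: a Noetherian local domain of characteristic `p`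
  haveI : IsDomain S := isDomain_of_isRegularLocalRing S
  have hQtop : Q ≠ ⊤ := ‹Q.IsPrime›.ne_top
  haveI : Nontrivial (S ⧸ Q) := Ideal.Quotient.nontrivial_iff.mpr hQtop
  haveI : IsDomain (S ⧸ Q) := Ideal.Quotient.isDomain Q
  haveI : IsLocalRing (S ⧸ Q) :=
    IsLocalRing.of_surjective' (Ideal.Quotient.mk Q) Ideal.Quotient.mk_surjective
  haveI : CharP (S ⧸ Q) p := charP_quotient_of_ne_top p Q hQtop
  have hFRat : IsFRational (S ⧸ Q) p := (isFRational_iff_of_isDomain p).mpr hFR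
  set π := Ideal.Quotient.mk Q with hπ
  -- the COLON CLAIM: `v·sᵢ ∈ (s_{<i}) ⇒ v ∈ (s_{<i})`
  have claim : ∀ i : Fin d, ∀ v : S ⧸ Q, v * s i ∈ Ideal.span (s '' Set.Iio i) →
      v ∈ Ideal.span (s '' Set.Iio i) := by
    intro i v hv
    -- dimension bookkeeping: `dim S = n`, `d ≤ n`
    obtain ⟨n, hn⟩ := exists_nat_cast_eq_ringKrullDim (R := S)
    have hdn : d ≤ n := by
      have h := ringKrullDim_le_of_surjective π Ideal.Quotient.mk_surjective
      rw [hn, hd] at h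
      exact_mod_cast h
    -- (a) `y ⊆ Q` with `dim S/(y) = d`
    obtain ⟨y, hyQ, hyd⟩ := colonCapturing_exists_prefix S Q hn hd
    -- (b) lifts `x` of `s` with `(y, x)` a system of parameters of `S`
    set x₀ : Fin d → S := fun j => (Ideal.Quotient.mk_surjective (s j)).choose with hx₀
    have hx₀s : ∀ j, π (x₀ j) = s j := fun j => (Ideal.Quotient.mk_surjective (s j)).choose_spec
    have hx₀rad : (Ideal.span (Set.range fun j => Ideal.Quotient.mk Q (x₀ j))).radical.IsMaximal := by
      have : (fun j => Ideal.Quotient.mk Q (x₀ j)) = s := funext hx₀s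
      rw [this]
      exact hs
    obtain ⟨x, hxQ, hsop⟩ := colonCapturing_exists_lifts S Q y hyQ hyd hd x₀ hx₀rad
    have hxs : ∀ j, π (x j) = s j := fun j => by
      rw [← hx₀s j, hπ, Ideal.Quotient.mk_eq_mk_iff_sub_mem]
      exact hxQ j
    -- (c) `Q` is minimal over `(y)`, whence the multiplier `c ∉ Q` with `c·Q^N ⊆ (y)`
    have hJQ : Ideal.span (Set.range y) ≤ Q := Ideal.span_le.mpr (by rintro _ ⟨j, rfl⟩; exact hyQ j)
    have hQmin : Q ∈ (Ideal.span (Set.range y)).minimalPrimes := by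
      refine ⟨⟨inferInstance, hJQ⟩, fun P ⟨hP, hJP⟩ hPQ => ?_⟩
      have hdimP : ringKrullDim (S ⧸ P) = d := by
        refine le_antisymm ?_ ?_
        · have h := ringKrullDim_le_of_surjective (Ideal.Quotient.factor hJP)
            (Ideal.Quotient.factor_surjective hJP)
          rwa [hyd] at h
        · have h := ringKrullDim_le_of_surjective (Ideal.Quotient.factor hPQ)
            (Ideal.Quotient.factor_surjective hPQ)
          rwa [hd] at h
      exact (eq_of_le_of_ringKrullDim_quotient_eq' hP hPQ hdimP hd).ge
    obtain ⟨c, hcQ, N, hcN⟩ := colonCapturing_exists_mul_pow_mem S (Ideal.span (Set.range y)) Q hQmin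
    -- (d) lift `v` and the relation upstairs
    obtain ⟨u, rfl⟩ := Ideal.Quotient.mk_surjective v
    have hmapI : ∀ e : ℕ, (Ideal.span ((fun j : Fin d => x j ^ p ^ e) '' Set.Iio i)).map π =
        Ideal.span ((fun j : Fin d => s j ^ p ^ e) '' Set.Iio i) := by
      intro e
      rw [Ideal.map_span, Set.image_image]
      congr 1
      ext r
      simp only [Set.mem_image, map_pow, hxs]
    have hu : u * x i ∈ Ideal.span (x '' Set.Iio i) ⊔ Q := by
      have h1 : π (u * x i) ∈ (Ideal.span (x '' Set.Iio i)).map π := by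
        rw [Ideal.map_span, Set.image_image]
        have : (fun j => π (x j)) '' Set.Iio i = s '' Set.Iio i := by
          ext r; simp only [Set.mem_image, hxs]
        rw [this, map_mul, hxs]
        exact hv
      have h2 := Ideal.mem_comap.mpr h1
      rwa [Ideal.comap_map_of_surjective π Ideal.Quotient.mk_surjective,
        show Ideal.comap π ⊥ = Q from by rw [← RingHom.ker_eq_comap_bot, hπ, Ideal.mk_ker]] at h2
    have hdim : ringKrullDim S = ↑((n - d) + d) := by rw [Nat.sub_add_cancel hdn]; exact hn
    obtain ⟨e₀, he₀⟩ := colonCapturing_quotient p S Q hdim y x hyQ hsop c N hcN i u hu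
    -- (e) downstairs: `π c · v^q ∈ (s_{<i})^[q]` for `q = p^e`, `e ≥ e₀`, so `v ∈ (s_{<i})^*`
    have hcne : π c ≠ 0 := fun h => hcQ ((Ideal.Quotient.eq_zero_iff_mem).mp h)
    have hmem : π u ∈ tightClosure p (Ideal.span (s '' Set.Iio i)) := by
      refine (mem_tightClosure_iff p).mpr ⟨π c, (mem_minimalPrimesCompl_iff_ne_zero).mpr hcne, e₀,
        fun e he => ?_⟩
      rw [frobeniusPower_span, Set.image_image]
      have h1 : π (c * u ^ p ^ e) ∈
          (Ideal.span ((fun j : Fin d => x j ^ p ^ e) '' Set.Iio i) ⊔ Q).map π :=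
        Ideal.mem_map_of_mem _ (he₀ e he)
      rw [Ideal.map_sup, Ideal.map_quotient_self, sup_bot_eq, hmapI] at h1
      simpa only [map_mul, map_pow] using h1
    -- (f) partial parameter ideals are tightly closed
    have hsop' : IsSystemOfParameters s := isSystemOfParameters_iff.mpr ⟨hd, hs⟩
    have htc := isTightlyClosed_span_image_Iio_of_isFRational p (S ⧸ Q) hFRat s hsop' i
    rw [IsTightlyClosed] at htc
    rw [← htc]
    exact hmem
  -- from the colon claim to weak regularity of the list
  refine (RingTheory.Sequence.isWeaklyRegular_iff_Fin _ _).mpr fun i => ?_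
  have hi : (i : ℕ) < d := by simpa only [List.length_ofFn] using i.2
  set i' : Fin d := ⟨i, hi⟩ with hi'
  have hget : (List.ofFn s)[i] = s i' := by simp only [Fin.getElem_fin, List.getElem_ofFn]; rfl
  rw [hget, show ((List.ofFn s).take i) = (List.ofFn s).take i' from rfl,
    ofList_take_ofFn_eq_span_image_Iio s i']
  exact isSMulRegular_quotient_of_colon _ _ (claim i')

end Summit.ResolutionOfSingularities.ResolutionOfSingularities.Theorems.FRationalResolution

end
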